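import Literature.NumberTheory.LFunctions.Zhang2022.Section12WindowPairs
import HarnessLib

/-!
# Zhang (2022) §12 pp. 66–67: the LONG-window regime of the absolute-value bound for `S_j(𝐛,𝐛̄)`
# with `O(1)` window coefficients, and the harmonic sum over a logarithmic window

Topic `Literature/NumberTheory/LFunctions/Zhang2022` (Landau–Siegel audit tree; verdict-neutral).
Y. Zhang, *Discrete mean estimates and the Landau–Siegel zero*, arXiv:2211.02515v1 (2022)
[Zhang2022LandauSiegel], §12 pp. 66–67 ((12.6), (12.8): "These bounds together with (8.25) and
(8.26) imply (12.6)", the displays (8.25)/(8.26) being absent from v1) — **an unrefereed manuscript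
under adjudication; nothing here asserts or denies its Theorems 1–2.** ZHANG-L discharge lane, WP12
helper under leaf hXi `Typed.Sec12A.Xi15Hbar16 c′` (cores hS/hS′ = `S_j(𝐛,𝐛̄) = o(α𝔞)` for the
`O(1)` window sequences of `H₁₅ − H̃₁₅` and of its dual). Companion of `Section12WindowPairs`
(degenerate-window regime, heights `X/k < H₀`): here the complementary regime `X/k ≥ H₀`, where both
inner windows `{m : |log(km/X)| ≤ θ}` are long — the `m`-sum is a harmonic sum over a logarithmic
window (`≤ 6θ + 2k/X`), and the `n`-sum is whatever short-interval mean of the majorant of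
`|ξ₀ⱼ(n;d,r)|` the caller supplies (hypothesis `ν`; with the TRUE-SIZE majorant, Shiu with exponent
`a = 1`, `ν ≍ θ`). Pure finite-sum bookkeeping, THEOREMS ONLY, 0 definitions:

* `sum_inv_logWindow_le` — `Σ_{m∈S, |log(km/X)|≤θ} 1/m ≤ 6θ + 2k/X` (`0 ≤ θ ≤ 1/2`, `S ⊆ ℕ_{≥1}`);
* `longWindow_regime_le` — **`Σ_{k∈K} w(k)·(Σ_{m: win} B₁/m)·(Σ_{n: win} B₂g_k(n)/n)
  ≤ B₁B₂·(6θ + 2/H₀)·ν·W`** for `k·H₀ ≤ X` on `K`, `n`-window means `≤ ν`, `Σ_{k∈K} w(k) ≤ W`;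
* `twoRegime_le` — the sum over `K = K₁ ∪ K₂` (disjoint) is at most the sum of the two regime bounds.

## References

* Y. Zhang, arXiv:2211.02515v1 (2022), §12 pp. 66–67; §7 Prop. 7.1 p.33 (`S_j`).
  [cite: Zhang2022LandauSiegel, §12 (12.6) p.67]
-/

noncomputable section

open Real Finset
open scoped Classical

namespace Literature.NumberTheory.LFunctions.Zhang2022.WindowRegimes

/-- `e^u − 1 ≤ 3u` for `0 ≤ u ≤ 1`. [folklore] -/
private theorem exp_sub_one_le_three_mul' {u : ℝ} (hu0 : 0 ≤ u) (hu1 : u ≤ 1) :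
    Real.exp u - 1 ≤ 3 * u := by
  have hpos : 0 < Real.exp u := Real.exp_pos _
  have hineq := Real.add_one_le_exp (-u)
  rw [Real.exp_neg] at hineq
  have h2 : (-u + 1) * Real.exp u ≤ 1 := by
    have := mul_le_mul_of_nonneg_right hineq hpos.le
    rwa [inv_mul_cancel₀ hpos.ne'] at this
  have h3 : Real.exp u ≤ Real.exp 1 := Real.exp_le_exp.mpr hu1
  have h4 : Real.exp 1 < 3 := lt_trans Real.exp_one_lt_d9 (by norm_num)
  nlinarith

/-! ## The harmonic sum over a logarithmic window -/

/-- **Harmonic sum over the window `|log(km/X)| ≤ θ`**: for `X > 0`, `k ≥ 1`, `0 ≤ θ ≤ 1/2` and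
`S ⊆ ℕ_{≥1}`, `Σ_{m∈S, |log(km/X)|≤θ} 1/m ≤ 6θ + 2k/X` (the window is `[he^{−θ}, he^{θ}]`, `h = X/k`:
at most `h(e^{θ} − e^{−θ}) + 1` integers, each `1/m ≤ e^{θ}/h`).
[cite: Zhang2022LandauSiegel, §12 p.67] -/
theorem sum_inv_logWindow_le {X θ : ℝ} (hX : 0 < X) (hθ0 : 0 ≤ θ) (hθ1 : θ ≤ 1 / 2)
    (S : Finset ℕ) (hS : ∀ m ∈ S, 0 < m) {k : ℕ} (hk : 0 < k) :
    ∑ m ∈ S.filter (fun m : ℕ => |Real.log ((k : ℝ) * (m : ℝ) / X)| ≤ θ), (1 : ℝ) / (m : ℝ) ≤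
      6 * θ + 2 * (k : ℝ) / X := by
  have hkR : (0 : ℝ) < k := by exact_mod_cast hk
  set h : ℝ := X / k with hh
  have hh0 : 0 < h := by rw [hh]; positivity
  set a : ℝ := h * Real.exp (-θ) with ha
  set b : ℝ := h * Real.exp θ with hb
  have ha0 : 0 < a := by positivity
  have hab : a ≤ b := by rw [ha, hb]; gcongr; linarith
  set T := S.filter (fun m : ℕ => |Real.log ((k : ℝ) * (m : ℝ) / X)| ≤ θ) with hT
  have hmem : ∀ m ∈ T, a ≤ (m : ℝ) ∧ (m : ℝ) ≤ b := by
    intro m hm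
    rw [hT, Finset.mem_filter] at hm
    have hm0 : (0 : ℝ) < m := by exact_mod_cast hS m hm.1
    have hq : 0 < (k : ℝ) * (m : ℝ) / X := by positivity
    obtain ⟨hlo, hhi⟩ := abs_le.mp hm.2
    have e1 : Real.exp (-θ) ≤ (k : ℝ) * m / X := by
      have := Real.exp_le_exp.mpr hlo; rwa [Real.exp_log hq] at this
    have e2 : (k : ℝ) * m / X ≤ Real.exp θ := by
      have := Real.exp_le_exp.mpr hhi; rwa [Real.exp_log hq] at this
    constructor
    · rw [ha, hh]
      have := (le_div_iff₀ hX).mp e1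
      rw [div_mul_eq_mul_div, div_le_iff₀ hkR]
      linarith
    · rw [hb, hh]
      have := (div_le_iff₀ hX).mp e2
      rw [div_mul_eq_mul_div, le_div_iff₀ hkR]
      linarith
  have hsub : T ⊆ Finset.Icc ⌈a⌉₊ ⌊b⌋₊ := by
    intro m hm
    obtain ⟨h1, h2⟩ := hmem m hm
    rw [Finset.mem_Icc]
    exact ⟨Nat.ceil_le.mpr h1, Nat.le_floor h2⟩
  have hterm : ∀ m ∈ T, (1 : ℝ) / (m : ℝ) ≤ 1 / a := fun m hm =>
    one_div_le_one_div_of_le ha0 (hmem m hm).1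
  have hcard : ((Finset.Icc ⌈a⌉₊ ⌊b⌋₊).card : ℝ) ≤ b - a + 1 := by
    rw [Nat.card_Icc]
    have h2 : (⌊b⌋₊ : ℝ) ≤ b := Nat.floor_le (by positivity)
    have h3 : a ≤ (⌈a⌉₊ : ℝ) := Nat.le_ceil a
    rcases le_or_gt ⌈a⌉₊ (⌊b⌋₊ + 1) with hc | hc
    · rw [Nat.cast_sub hc]; push_cast; linarith
    · rw [Nat.sub_eq_zero_of_le hc.le]; push_cast; linarith
  have hexp2 : Real.exp (2 * θ) - 1 ≤ 3 * (2 * θ) :=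
    exp_sub_one_le_three_mul' (by linarith) (by linarith)
  have hexp1 : Real.exp θ ≤ 2 := by
    have := exp_sub_one_le_three_mul' hθ0 (by linarith)
    have h16 : Real.exp θ ≤ Real.exp (1 / 2) := Real.exp_le_exp.mpr hθ1
    have hhalf : Real.exp (1 / 2) - 1 ≤ 3 * (1 / 2) := exp_sub_one_le_three_mul' (by norm_num) (by norm_num)
    -- sharper: `e^{1/2} ≤ 2` from `e < 3`? use `exp(1/2)^2 = e < 4`
    have hsq : Real.exp (1 / 2) * Real.exp (1 / 2) = Real.exp 1 := by
      rw [← Real.exp_add]; norm_num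
    have he : Real.exp 1 < 4 := lt_trans Real.exp_one_lt_d9 (by norm_num)
    have hpos : 0 < Real.exp (1 / 2) := Real.exp_pos _
    nlinarith
  calc ∑ m ∈ T, (1 : ℝ) / (m : ℝ)
      ≤ ∑ m ∈ T, 1 / a := Finset.sum_le_sum hterm
    _ = (T.card : ℝ) * (1 / a) := by rw [Finset.sum_const, nsmul_eq_mul]
    _ ≤ ((Finset.Icc ⌈a⌉₊ ⌊b⌋₊).card : ℝ) * (1 / a) := by gcongr
    _ ≤ (b - a + 1) * (1 / a) := by gcongr
    _ = (Real.exp θ * Real.exp θ - 1) + Real.exp θ / h := by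
        rw [ha, hb]
        have hexp : Real.exp (-θ) = (Real.exp θ)⁻¹ := Real.exp_neg _
        have hE : Real.exp θ ≠ 0 := (Real.exp_pos _).ne'
        rw [hexp]
        field_simp
    _ ≤ 6 * θ + 2 * (k : ℝ) / X := by
        have h4 : Real.exp θ * Real.exp θ = Real.exp (2 * θ) := by
          rw [← Real.exp_add]; ring_nf
        rw [h4]
        have hB : Real.exp θ / h ≤ 2 * (k : ℝ) / X := by
          rw [hh, div_div_eq_mul_div, div_le_div_iff₀ hX hX]
          exact mul_le_mul_of_nonneg_right (mul_le_mul_of_nonneg_right hexp1 hkR.le) hX.le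
        linarith

/-! ## The long-window regime -/

/-- **Long-window regime.** For `X > 0`, `0 ≤ θ ≤ 1/2`, `H₀ > 0`, finite `K, S ⊆ ℕ_{≥1}` with
`k·H₀ ≤ X` for `k ∈ K` (height `X/k ≥ H₀`), nonnegative weights `w` with `Σ_{k∈K} w(k) ≤ W`, and
`n`-side majorants `g k n ≥ 0` whose window means satisfy `Σ_{n∈S, |log(kn/X)|≤θ} g k n / n ≤ ν`
(`k ∈ K`):
`Σ_{k∈K} w(k)·(Σ_{m∈S, |log(km/X)|≤θ} B₁/m)·(Σ_{n∈S, |log(kn/X)|≤θ} B₂ g k n/n) ≤ B₁B₂(6θ + 2/H₀)·ν·W`.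
[cite: Zhang2022LandauSiegel, §12 p.67] -/
theorem longWindow_regime_le {X θ H₀ ν W B₁ B₂ : ℝ} (hX : 0 < X) (hθ0 : 0 ≤ θ) (hθ1 : θ ≤ 1 / 2)
    (hH₀ : 0 < H₀) (hν : 0 ≤ ν) (hB₁ : 0 ≤ B₁) (hB₂ : 0 ≤ B₂) (K S : Finset ℕ)
    (hK : ∀ k ∈ K, 0 < k) (hKH : ∀ k ∈ K, (k : ℝ) * H₀ ≤ X) (hS : ∀ m ∈ S, 0 < m)
    (w : ℕ → ℝ) (g : ℕ → ℕ → ℝ) (hw : ∀ k, 0 ≤ w k) (hg : ∀ k n, 0 ≤ g k n)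
    (hW : ∑ k ∈ K, w k ≤ W)
    (hνk : ∀ k ∈ K, ∑ n ∈ S.filter (fun n : ℕ => |Real.log ((k : ℝ) * (n : ℝ) / X)| ≤ θ),
      g k n / (n : ℝ) ≤ ν) :
    ∑ k ∈ K, w k *
        ((∑ m ∈ S.filter (fun m : ℕ => |Real.log ((k : ℝ) * (m : ℝ) / X)| ≤ θ), B₁ / (m : ℝ)) *
          (∑ n ∈ S.filter (fun n : ℕ => |Real.log ((k : ℝ) * (n : ℝ) / X)| ≤ θ),
            B₂ * g k n / (n : ℝ))) ≤
      B₁ * B₂ * (6 * θ + 2 / H₀) * ν * W := by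
  have hterm : ∀ k ∈ K, w k *
      ((∑ m ∈ S.filter (fun m : ℕ => |Real.log ((k : ℝ) * (m : ℝ) / X)| ≤ θ), B₁ / (m : ℝ)) *
        (∑ n ∈ S.filter (fun n : ℕ => |Real.log ((k : ℝ) * (n : ℝ) / X)| ≤ θ),
          B₂ * g k n / (n : ℝ))) ≤
      w k * (B₁ * (6 * θ + 2 / H₀) * (B₂ * ν)) := by
    intro k hk
    have hk0 := hK k hk
    have hkR : (0 : ℝ) < k := by exact_mod_cast hk0
    -- the `m`-window harmonic sum
    have hM : ∑ m ∈ S.filter (fun m : ℕ => |Real.log ((k : ℝ) * (m : ℝ) / X)| ≤ θ), B₁ / (m : ℝ) ≤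
        B₁ * (6 * θ + 2 / H₀) := by
      have h1 : ∑ m ∈ S.filter (fun m : ℕ => |Real.log ((k : ℝ) * (m : ℝ) / X)| ≤ θ), B₁ / (m : ℝ) =
          B₁ * ∑ m ∈ S.filter (fun m : ℕ => |Real.log ((k : ℝ) * (m : ℝ) / X)| ≤ θ),
            (1 : ℝ) / (m : ℝ) := by
        rw [Finset.mul_sum]
        refine Finset.sum_congr rfl fun m _ => ?_
        ring
      rw [h1]
      refine mul_le_mul_of_nonneg_left ?_ hB₁
      refine (sum_inv_logWindow_le hX hθ0 hθ1 S hS hk0).trans ?_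
      have hkX : 2 * (k : ℝ) / X ≤ 2 / H₀ := by
        rw [div_le_div_iff₀ hX hH₀]
        have := hKH k hk
        nlinarith
      linarith
    -- the `n`-window mean
    have hN : ∑ n ∈ S.filter (fun n : ℕ => |Real.log ((k : ℝ) * (n : ℝ) / X)| ≤ θ),
        B₂ * g k n / (n : ℝ) ≤ B₂ * ν := by
      have h1 : ∑ n ∈ S.filter (fun n : ℕ => |Real.log ((k : ℝ) * (n : ℝ) / X)| ≤ θ),
          B₂ * g k n / (n : ℝ) =
          B₂ * ∑ n ∈ S.filter (fun n : ℕ => |Real.log ((k : ℝ) * (n : ℝ) / X)| ≤ θ),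
            g k n / (n : ℝ) := by
        rw [Finset.mul_sum]
        refine Finset.sum_congr rfl fun n _ => ?_
        ring
      rw [h1]
      exact mul_le_mul_of_nonneg_left (hνk k hk) hB₂
    have hM0 : 0 ≤ ∑ m ∈ S.filter (fun m : ℕ => |Real.log ((k : ℝ) * (m : ℝ) / X)| ≤ θ),
        B₁ / (m : ℝ) := Finset.sum_nonneg fun m _ => div_nonneg hB₁ (Nat.cast_nonneg m)
    have hN0 : 0 ≤ ∑ n ∈ S.filter (fun n : ℕ => |Real.log ((k : ℝ) * (n : ℝ) / X)| ≤ θ),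
        B₂ * g k n / (n : ℝ) :=
      Finset.sum_nonneg fun n _ => div_nonneg (mul_nonneg hB₂ (hg k n)) (Nat.cast_nonneg n)
    exact mul_le_mul_of_nonneg_left (mul_le_mul hM hN hN0 (by positivity)) (hw k)
  calc ∑ k ∈ K, w k *
        ((∑ m ∈ S.filter (fun m : ℕ => |Real.log ((k : ℝ) * (m : ℝ) / X)| ≤ θ), B₁ / (m : ℝ)) *
          (∑ n ∈ S.filter (fun n : ℕ => |Real.log ((k : ℝ) * (n : ℝ) / X)| ≤ θ),
            B₂ * g k n / (n : ℝ)))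
      ≤ ∑ k ∈ K, w k * (B₁ * (6 * θ + 2 / H₀) * (B₂ * ν)) := Finset.sum_le_sum hterm
    _ = (∑ k ∈ K, w k) * (B₁ * (6 * θ + 2 / H₀) * (B₂ * ν)) := by rw [Finset.sum_mul]
    _ ≤ W * (B₁ * (6 * θ + 2 / H₀) * (B₂ * ν)) :=
        mul_le_mul_of_nonneg_right hW (by positivity)
    _ = B₁ * B₂ * (6 * θ + 2 / H₀) * ν * W := by ring

/-! ## Gluing the two regimes -/

/-- **Two regimes.** If `K = K₁ ∪ K₂` with `K₁, K₂` disjoint and the `k`-sums of a nonnegative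
summand over `K₁`, `K₂` are bounded by `E₁`, `E₂`, the sum over `K` is bounded by `E₁ + E₂` — the
split of the `k = dr` range at height `X/k = H₀` between `longWindow_regime_le` (`K₁`) and
`degenerate_regime_le` (`K₂`). [cite: Zhang2022LandauSiegel, §12 p.67] -/
theorem twoRegime_le {K K₁ K₂ : Finset ℕ} (hK : K = K₁ ∪ K₂) (hdisj : Disjoint K₁ K₂)
    (Φ : ℕ → ℝ) {E₁ E₂ : ℝ} (h₁ : ∑ k ∈ K₁, Φ k ≤ E₁) (h₂ : ∑ k ∈ K₂, Φ k ≤ E₂) :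
    ∑ k ∈ K, Φ k ≤ E₁ + E₂ := by
  rw [hK, Finset.sum_union hdisj]
  exact add_le_add h₁ h₂

end Literature.NumberTheory.LFunctions.Zhang2022.WindowRegimes
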